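import Literature.Combinatorics.LorentzianPolynomials.MConvexGenerating
import Literature.Combinatorics.LorentzianPolynomials.RayleighSupportMConvex
import Literature.Combinatorics.LorentzianPolynomials.HodgeRiemann
import HarnessLib

/-!
# Brändén–Huh Theorem 3.10, the Rayleigh conditions (2), (3), (5), (6)

Layer `Literature/Combinatorics/LorentzianPolynomials`, namespace `Literature.Combinatorics.LorentzianPolynomials`;
lane `lit-hodgefound` (Track 2 foundations library), seat p16, generation 29 (row g29-#14). `MConvexGenerating.lean`
(gen 27) proves Theorem 3.10's equivalence of (1) "there is a Lorentzian polynomial whose support is `J`", (4)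
"`f_J` is Lorentzian" and (7) "`J` is M-convex" (`isMConvex_iff_exists_support_eq`,
`isMConvex_iff_genPolyNorm_mem_lorentzian`), and `MatroidBases.lean` the `0/1` case (8). This file adds the four
`c`-Rayleigh conditions (2), (3), (5), (6), now that both inputs are in the tree: Proposition 2.19 ("every Lorentzian
polynomial is `2(1 - 1/d)`-Rayleigh", `HodgeRiemann.isCRayleigh_two_of_mem_lorentzian`) for (4) ⟹ (5) and
(1) ⟹ (2), and Theorem 2.23 ("the support of a homogeneous `c`-Rayleigh polynomial is M-convex",
`RayleighSupportMConvex.isMConvex_support_of_isCRayleigh`) for (6) ⟹ (7) and (3) ⟹ (7).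

## Source (verbatim) — P. Brändén, J. Huh, *Lorentzian polynomials* [BrandenHuh2019] (held `paper:arxiv-1902.03719`)

§3.2 (p. 34): "**Theorem 3.10.** The following are equivalent for any nonempty `J ⊆ ℕ^n`. (1) There is a Lorentzian
polynomial whose support is `J`. (2) There is a homogeneous `2`-Rayleigh polynomial whose support is `J`. (3) There is
a homogeneous `c`-Rayleigh polynomial whose support is `J` for some `c > 0`. (4) The generating function `f_J` is a
Lorentzian polynomial. (5) The generating function `f_J` is a homogeneous `2`-Rayleigh polynomial. (6) The generating
function `f_J` is a homogeneous `c`-Rayleigh polynomial for some `c > 0`. (7) `J` is M-convex." §3.2 (p. 36, proof):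
"If `f` is a homogeneous `c`-Rayleigh polynomial for some `c > 0`, then its support is M-convex by Theorem 2.23. Since
Lorentzian polynomials are `2`-Rayleigh by Proposition 2.19, it remains to prove (7) ⟹ (4)."

## What is here

For `J ⊆ Δ^d_n` (a `Finset` of exponents of degree `d`; the tree's setting of Theorem 3.10, `genPolyNorm J = f_J`):
`isCRayleigh_two_genPolyNorm_of_isMConvex` ((7) ⟹ (5)), `isMConvex_of_isCRayleigh_genPolyNorm` ((6) ⟹ (7)),
`isMConvex_of_isCRayleigh_of_support_eq` ((3) ⟹ (7)), and the equivalences with (7):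
`isMConvex_iff_isCRayleigh_two_genPolyNorm` (5), `isMConvex_iff_exists_isCRayleigh_genPolyNorm` (6),
`isMConvex_iff_exists_isCRayleigh_two_support_eq` (2), `isMConvex_iff_exists_isCRayleigh_support_eq` (3). Homogeneity
is automatic for a polynomial supported in `Δ^d_n` (`isHomogeneous_of_support_eq`).

Theorems only; no `sorry`, no named fact (net debt 0).

## References

* [BrandenHuh2019] P. Brändén, J. Huh, *Lorentzian polynomials*, Ann. of Math. (2) 192 (2020) 821–891,
  arXiv:1902.03719 — §3.2 Thm. 3.10 (p. 34) and its proof (p. 36); §2.4 Prop. 2.19, Thm. 2.23.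
-/

noncomputable section

open MvPolynomial Finsupp Finset

namespace Literature.Combinatorics.LorentzianPolynomials

variable {σ : Type*} [Fintype σ] [DecidableEq σ]

section Theorem310

omit [Fintype σ] [DecidableEq σ] in
/-- A polynomial whose support consists of exponents of degree `d` is homogeneous of degree `d` (so "homogeneous" is
automatic in (2), (3) for `J ⊆ Δ^d_n`). [cite: BrandenHuh2019, §3.2 Thm. 3.10 ("any one of the above conditions" for
`J ⊆ ℕ^n`); §2.1 (p. 8, `H^d_n`)] -/
theorem isHomogeneous_of_support_eq {f : MvPolynomial σ ℝ} {J : Finset (σ →₀ ℕ)} {d : ℕ}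
    (hJd : ∀ α ∈ J, α.degree = d) (hJ : {β : σ →₀ ℕ | coeff β f ≠ 0} = (J : Set (σ →₀ ℕ))) :
    f.IsHomogeneous d := by
  intro β hβ
  have hβJ : β ∈ J := by
    have h : β ∈ {β : σ →₀ ℕ | coeff β f ≠ 0} := hβ
    rw [hJ] at h
    exact Finset.mem_coe.1 h
  have h := hJd β hβJ
  rw [Finsupp.degree_eq_weight_one] at h
  exact h

/-- **(7) ⟹ (5)**: if `J ⊆ Δ^d_n` is M-convex, then `f_J` is `2`-Rayleigh ("Lorentzian polynomials are `2`-Rayleigh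
by Proposition 2.19", applied to (7) ⟹ (4)). [cite: BrandenHuh2019, §3.2 Thm. 3.10, (7) ⟹ (4) ⟹ (5)] -/
theorem isCRayleigh_two_genPolyNorm_of_isMConvex {J : Finset (σ →₀ ℕ)} {d : ℕ} (hJd : ∀ α ∈ J, α.degree = d)
    (hM : IsMConvex (J : Set (σ →₀ ℕ))) : IsCRayleigh 2 (genPolyNorm J) :=
  isCRayleigh_two_of_mem_lorentzian (genPolyNorm_mem_lorentzian hJd hM)

/-- **(6) ⟹ (7)**: if `f_J` is `c`-Rayleigh (for `J ⊆ Δ^d_n`; any `c`), then `J` is M-convex ("its support is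
M-convex by Theorem 2.23"). [cite: BrandenHuh2019, §3.2 Thm. 3.10, (6) ⟹ (7); §2.4 Thm. 2.23] -/
theorem isMConvex_of_isCRayleigh_genPolyNorm {J : Finset (σ →₀ ℕ)} {d : ℕ} (hJd : ∀ α ∈ J, α.degree = d) {c : ℝ}
    (h : IsCRayleigh c (genPolyNorm J)) : IsMConvex (J : Set (σ →₀ ℕ)) := by
  rw [← support_genPolyNorm J]
  exact isMConvex_support_of_isCRayleigh h (isHomogeneous_genPolyNorm hJd)

/-- **(3) ⟹ (7)**: if some `c`-Rayleigh polynomial has support `J ⊆ Δ^d_n`, then `J` is M-convex (Theorem 2.23).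
[cite: BrandenHuh2019, §3.2 Thm. 3.10, (3) ⟹ (7); §2.4 Thm. 2.23] -/
theorem isMConvex_of_isCRayleigh_of_support_eq {J : Finset (σ →₀ ℕ)} {d : ℕ} (hJd : ∀ α ∈ J, α.degree = d)
    {c : ℝ} {f : MvPolynomial σ ℝ} (h : IsCRayleigh c f) (hJ : {β : σ →₀ ℕ | coeff β f ≠ 0} = (J : Set (σ →₀ ℕ))) :
    IsMConvex (J : Set (σ →₀ ℕ)) := by
  rw [← hJ]
  exact isMConvex_support_of_isCRayleigh h (isHomogeneous_of_support_eq hJd hJ)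

/-- **Theorem 3.10, (7) ⟺ (5)**: `J ⊆ Δ^d_n` is M-convex iff `f_J` is `2`-Rayleigh.
[cite: BrandenHuh2019, §3.2 Thm. 3.10 (p. 34)] -/
theorem isMConvex_iff_isCRayleigh_two_genPolyNorm {J : Finset (σ →₀ ℕ)} {d : ℕ} (hJd : ∀ α ∈ J, α.degree = d) :
    IsMConvex (J : Set (σ →₀ ℕ)) ↔ IsCRayleigh 2 (genPolyNorm J) :=
  ⟨isCRayleigh_two_genPolyNorm_of_isMConvex hJd, isMConvex_of_isCRayleigh_genPolyNorm hJd⟩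

/-- **Theorem 3.10, (7) ⟺ (6)**: `J ⊆ Δ^d_n` is M-convex iff `f_J` is `c`-Rayleigh for some `c > 0`.
[cite: BrandenHuh2019, §3.2 Thm. 3.10 (p. 34)] -/
theorem isMConvex_iff_exists_isCRayleigh_genPolyNorm {J : Finset (σ →₀ ℕ)} {d : ℕ} (hJd : ∀ α ∈ J, α.degree = d) :
    IsMConvex (J : Set (σ →₀ ℕ)) ↔ ∃ c : ℝ, 0 < c ∧ IsCRayleigh c (genPolyNorm J) :=
  ⟨fun h ↦ ⟨2, two_pos, isCRayleigh_two_genPolyNorm_of_isMConvex hJd h⟩,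
    fun ⟨_, _, h⟩ ↦ isMConvex_of_isCRayleigh_genPolyNorm hJd h⟩

/-- **Theorem 3.10, (7) ⟺ (2)**: `J ⊆ Δ^d_n` is M-convex iff some (homogeneous) `2`-Rayleigh polynomial has support
exactly `J`. [cite: BrandenHuh2019, §3.2 Thm. 3.10 (p. 34)] -/
theorem isMConvex_iff_exists_isCRayleigh_two_support_eq {J : Finset (σ →₀ ℕ)} {d : ℕ}
    (hJd : ∀ α ∈ J, α.degree = d) :
    IsMConvex (J : Set (σ →₀ ℕ)) ↔
      ∃ f : MvPolynomial σ ℝ, IsCRayleigh 2 f ∧ {β : σ →₀ ℕ | coeff β f ≠ 0} = (J : Set (σ →₀ ℕ)) :=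
  ⟨fun h ↦ ⟨genPolyNorm J, isCRayleigh_two_genPolyNorm_of_isMConvex hJd h, support_genPolyNorm J⟩,
    fun ⟨_, hf, hJ⟩ ↦ isMConvex_of_isCRayleigh_of_support_eq hJd hf hJ⟩

/-- **Theorem 3.10, (7) ⟺ (3)**: `J ⊆ Δ^d_n` is M-convex iff some (homogeneous) `c`-Rayleigh polynomial, `c > 0`, has
support exactly `J`. [cite: BrandenHuh2019, §3.2 Thm. 3.10 (p. 34)] -/
theorem isMConvex_iff_exists_isCRayleigh_support_eq {J : Finset (σ →₀ ℕ)} {d : ℕ} (hJd : ∀ α ∈ J, α.degree = d) :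
    IsMConvex (J : Set (σ →₀ ℕ)) ↔ ∃ (f : MvPolynomial σ ℝ) (c : ℝ), 0 < c ∧ IsCRayleigh c f ∧
      {β : σ →₀ ℕ | coeff β f ≠ 0} = (J : Set (σ →₀ ℕ)) :=
  ⟨fun h ↦ ⟨genPolyNorm J, 2, two_pos, isCRayleigh_two_genPolyNorm_of_isMConvex hJd h, support_genPolyNorm J⟩,
    fun ⟨_, _, _, hf, hJ⟩ ↦ isMConvex_of_isCRayleigh_of_support_eq hJd hf hJ⟩

/-- **Theorem 3.10, (1) ⟺ (2)** (through (7)): some Lorentzian polynomial of degree `d` has support `J` iff some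
`2`-Rayleigh polynomial has support `J`. [cite: BrandenHuh2019, §3.2 Thm. 3.10 (p. 34); §2.4 Prop. 2.19, Thm. 2.23] -/
theorem exists_lorentzian_support_eq_iff_exists_isCRayleigh_two {J : Finset (σ →₀ ℕ)} {d : ℕ}
    (hJd : ∀ α ∈ J, α.degree = d) :
    (∃ f ∈ lorentzian σ d, {β : σ →₀ ℕ | coeff β f ≠ 0} = (J : Set (σ →₀ ℕ))) ↔
      ∃ f : MvPolynomial σ ℝ, IsCRayleigh 2 f ∧ {β : σ →₀ ℕ | coeff β f ≠ 0} = (J : Set (σ →₀ ℕ)) := by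
  rw [← isMConvex_iff_exists_support_eq hJd, isMConvex_iff_exists_isCRayleigh_two_support_eq hJd]

end Theorem310

end Literature.Combinatorics.LorentzianPolynomials

end
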